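import Summits.Ventures.Crystal3D.Kissing125.GSearchRules2
import HarnessLib

/-!
# Soundness of the node rule and of propagation, κ-generic — part 1/3

HONEST FRAMING (cell pub-crystal3d, K-path at `h = 5/4`, V4 = κ as an explicit parameter): this is NOT a result printed
by Hales; it is his METHOD (arXiv:1209.6043, Theorem 3 + Lemmas 7–10, in the tree's form of a verified interval-arithmetic
growth search, `Literature/…/KissingSearch*.lean`) with the largest long-side cosine `κ` made an EXPLICIT PARAMETER
(`κ : Kappa`, carrying the two numeric facts the soundness proof uses: `-1/2 ≤ κ`, `κ < 1/4`).  Only the declarations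
whose statement depends on `κ` are declared here (namespace `…Kissing125.GSearch`, the tree's short names, no renames);
every κ-free helper is the landed K25 copy (`…Kissing125.KissingSearch.*`) and every κ-free lemma is cited from the tree
(PRIVATE per-file citation aliases; `GSearchTransport.lean` holds `toT : St → tree St` and the transport equalities).  The K25
instance is `κ25 = ⟨7/32, …⟩`; `GSearchBridge.lean` identifies the generic checker at
`κ25` with the landed `Kissing125.KissingSearch.checkPart`, so the landed run files are consumed unchanged.  Generated by
`HOME/lean/kissing125/v4-prep/gen/mkgen.py`; nothing here is asserted about GAP(1.26) or any census.

THIS FILE: the κ-tainted declarations of `Literature/Geometry/DiscreteGeometry/KissingSearchNode.lean` (part 1 of 3), with `κ : Kappa` threaded; κ-free declarations of that file are NOT re-declared publicly (the κ-free helpers are the landed K25 copies; the κ-free tree lemmas used by the proofs are cited through PRIVATE aliases at the top of the file).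

## References
* T. C. Hales, *A proof of Fejes Tóth's conjecture on sphere packings with kissing number twelve*,
  arXiv:1209.6043 (2012): Definition 1, Theorem 2, Theorem 3, Lemmas 7–10. [`Hales2012`]
* R. E. Moore, *Interval Analysis* (1966), Theorem 3.1, §4.4. [`Moore1966`]
-/

namespace Summit.Ventures.Crystal3D.Kissing125

open Literature.Geometry.DiscreteGeometry
open Summit.Ventures.Crystal3D.Kissing125.KissingSearch

namespace GSearch

open Real Literature.Analysis.ValidatedNumerics KissingLP NonemptyInterval Finset

variable {κ : Kappa}

/-! ### κ-free tree lemmas used below, read over the K25 copies (PRIVATE citation aliases; the public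
surface of this file is κ-generic only) -/

/-- K25 reading of the tree lemma `eq_of_tset_eq` (κ-free; proof = citation of the tree lemma). [folklore] -/
private theorem eq_of_tset_eq {s t : ℕ} (hs : TriValid s) (ht : TriValid t)
  (hst : tset s = tset t) : s = t :=
  Literature.Geometry.DiscreteGeometry.KissingSearch.eq_of_tset_eq hs ht hst

/-- K25 reading of the tree lemma `exists_common_of_inter_two` (κ-free; proof = citation of the tree lemma). [folklore] -/
private theorem exists_common_of_inter_two {t t' : Finset ℕ} (v : ℕ)
  (h2 : #(t ∩ t') = 2) : ∃ x, x ≠ v ∧ x ∈ t ∧ x ∈ t' :=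
  Literature.Geometry.DiscreteGeometry.KissingSearch.exists_common_of_inter_two v h2

/-- K25 reading of the tree lemma `lt_of_mem_tset` (κ-free; proof = citation of the tree lemma). [folklore] -/
private theorem lt_of_mem_tset {t v : ℕ} (ht : TriValid t) (hv : v ∈ tset t) : v < 12 :=
  Literature.Geometry.DiscreteGeometry.KissingSearch.lt_of_mem_tset ht hv

/-- K25 reading of the tree lemma `others_spec` (κ-free; proof = citation of the tree lemma). [folklore] -/
private theorem others_spec {t v : ℕ} (ht : TriValid t) (hv : v ∈ tset t) :
  v ≠ (others t v).1 ∧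
    v ≠ (others t v).2 ∧ (others t v).1 ≠ (others t v).2 ∧ tset t = {v, (others t v).1, (others t v).2} :=
  Literature.Geometry.DiscreteGeometry.KissingSearch.others_spec ht hv

/-- K25 reading of the tree lemma `tmem_iff` (κ-free; proof = citation of the tree lemma). [folklore] -/
private theorem tmem_iff {t v : ℕ} : tmem t v = true ↔ v ∈ tset t :=
  Literature.Geometry.DiscreteGeometry.KissingSearch.tmem_iff


/-! ### Part A. Placed triangles on a side; link bookkeeping -/

section Counting

variable {M : KConf κ} {s : St}

/-- The images of the placed triangles through `{v, x}` form a subset of `M.onSide v x` of the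
same size as the list. [folklore] -/
theorem card_image_onSideL {M : KConf κ} {s : St} (hR : Realizes M s) (v x : ℕ) :
    ((s.onSideL v x).map tset).toFinset ⊆ M.onSide v x ∧
      ((s.onSideL v x).map tset).toFinset.card = (s.onSideL v x).length := by
  constructor
  · intro t'' ht''
    rw [List.mem_toFinset, List.mem_map] at ht''
    obtain ⟨t, ht, rfl⟩ := ht''
    unfold St.onSideL at ht
    rw [List.mem_filter] at ht
    simp only [Bool.and_eq_true] at ht
    unfold KConf.onSide
    rw [Finset.mem_filter]
    exact ⟨hR.mem t ht.1, tmem_iff.1 ht.2.1, tmem_iff.1 ht.2.2⟩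
  · rw [List.card_toFinset, List.dedup_eq_self.2, List.length_map]
    refine (List.nodup_map_iff_inj_on ?_).2 ?_
    · exact hR.nodup.filter _
    · intro t ht t' ht' e
      unfold St.onSideL at ht ht'
      exact eq_of_tset_eq (hR.valid t (List.mem_filter.1 ht).1) (hR.valid t' (List.mem_filter.1 ht').1) e

/-- `M.onSide v x` has two elements as soon as some placed triangle goes through `{v, x}`.
[folklore] -/
theorem card_onSide {M : KConf κ} {s : St} (hR : Realizes M s) {v x t : ℕ} (hvx : v ≠ x) (ht : t ∈ s.tris.toList)
    (hv : v ∈ tset t) (hx : x ∈ tset t) : (M.onSide v x).card = 2 :=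
  M.two _ (hR.mem t ht) v hv x hx hvx

/-- The cached count is the length of the placed list. [folklore] -/
theorem gsc_eq_length {M : KConf κ} {s : St} (hR : Realizes M s) {v x : ℕ} (hv : v < 12) (hx : x < 12) (hvx : v ≠ x) :
    s.gsc v x = (s.onSideL v x).length := hR.sc_eq v x hv hx hvx

/-- **At most two placed triangles on a side.** [folklore] -/
theorem gsc_le_two {M : KConf κ} {s : St} (hR : Realizes M s) {v x : ℕ} (hv : v < 12) (hx : x < 12) (hvx : v ≠ x) :
    s.gsc v x ≤ 2 := by
  rw [gsc_eq_length hR hv hx hvx]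
  obtain ⟨hsub, hcard⟩ := card_image_onSideL hR v x
  by_cases h0 : s.onSideL v x = []
  · rw [h0]; simp
  · obtain ⟨t, ht⟩ := List.exists_mem_of_ne_nil _ h0
    have ht' := ht
    unfold St.onSideL at ht'
    rw [List.mem_filter] at ht'
    simp only [Bool.and_eq_true] at ht'
    have h2 := card_onSide hR hvx ht'.1 (tmem_iff.1 ht'.2.1) (tmem_iff.1 ht'.2.2)
    rw [← hcard, ← h2]
    exact Finset.card_le_card hsub

/-- **Two placed triangles on a side are all the triangles of `M` on it.** [folklore] -/
theorem placed_of_gsc_two {M : KConf κ} {s : St} (hR : Realizes M s) {v x : ℕ} (hv : v < 12) (hx : x < 12) (hvx : v ≠ x)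
    (h2 : s.gsc v x = 2) {t'' : Finset ℕ} (hT : t'' ∈ M.T) (hv'' : v ∈ t'') (hx'' : x ∈ t'') :
    ∃ t ∈ s.tris.toList, tset t = t'' := by
  rw [gsc_eq_length hR hv hx hvx] at h2
  obtain ⟨hsub, hcard⟩ := card_image_onSideL hR v x
  obtain ⟨t, ht⟩ := List.exists_mem_of_ne_nil (s.onSideL v x) (by intro h; rw [h] at h2; simp at h2)
  have ht' := ht
  unfold St.onSideL at ht'
  rw [List.mem_filter] at ht'
  simp only [Bool.and_eq_true] at ht'
  have hc := card_onSide hR hvx ht'.1 (tmem_iff.1 ht'.2.1) (tmem_iff.1 ht'.2.2)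
  have heq : ((s.onSideL v x).map tset).toFinset = M.onSide v x :=
    Finset.eq_of_subset_of_card_le hsub (by rw [hc, hcard, h2])
  have hmem : t'' ∈ M.onSide v x := by unfold KConf.onSide; rw [Finset.mem_filter]; exact ⟨hT, hv'', hx''⟩
  rw [← heq, List.mem_toFinset, List.mem_map] at hmem
  obtain ⟨t₀, ht₀, e⟩ := hmem
  unfold St.onSideL at ht₀
  exact ⟨t₀, (List.mem_filter.1 ht₀).1, e⟩

/-- **One placed triangle on a side leaves an unplaced triangle of `M` on it.** [folklore] -/
theorem exists_unplaced_of_gsc_one {M : KConf κ} {s : St} (hR : Realizes M s) {v x : ℕ} (hv : v < 12) (hx : x < 12)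
    (hvx : v ≠ x) (h1 : s.gsc v x = 1) :
    ∃ t'' ∈ M.T, v ∈ t'' ∧ x ∈ t'' ∧ ∀ t ∈ s.tris.toList, tset t ≠ t'' := by
  rw [gsc_eq_length hR hv hx hvx] at h1
  obtain ⟨hsub, hcard⟩ := card_image_onSideL hR v x
  obtain ⟨t, ht⟩ := List.exists_mem_of_ne_nil (s.onSideL v x) (by intro h; rw [h] at h1; simp at h1)
  have ht' := ht
  unfold St.onSideL at ht'
  rw [List.mem_filter] at ht'
  simp only [Bool.and_eq_true] at ht'
  have hc := card_onSide hR hvx ht'.1 (tmem_iff.1 ht'.2.1) (tmem_iff.1 ht'.2.2)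
  -- an element of `M.onSide v x` outside the one-element image
  have hlt : ((s.onSideL v x).map tset).toFinset.card < (M.onSide v x).card := by rw [hcard, h1, hc]; norm_num
  obtain ⟨t'', ht''1, ht''2⟩ := Finset.exists_of_ssubset (Finset.ssubset_iff_subset_ne.2
    ⟨hsub, fun e => by rw [e] at hlt; exact lt_irrefl _ hlt⟩)
  unfold KConf.onSide at ht''1
  rw [Finset.mem_filter] at ht''1
  refine ⟨t'', ht''1.1, ht''1.2.1, ht''1.2.2, fun t₀ ht₀ e => ht''2 ?_⟩
  rw [List.mem_toFinset, List.mem_map]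
  refine ⟨t₀, ?_, e⟩
  unfold St.onSideL
  rw [List.mem_filter]
  simp only [Bool.and_eq_true]
  rw [← e] at ht''1
  exact ⟨ht₀, tmem_iff.2 ht''1.2.1, tmem_iff.2 ht''1.2.2⟩

/-- **Meaning of `linkNbrs`**: the third vertices of the placed triangles through `{v, x}`
(`x ≠ v`), for valid placed triangles. [folklore] -/
theorem mem_linkNbrs {M : KConf κ} {s : St} (hR : Realizes M s) {v x y : ℕ} (hxv : x ≠ v) :
    y ∈ s.linkNbrs v x ↔ ∃ t ∈ s.tris.toList, v ∈ tset t ∧ x ∈ tset t ∧ tset t = {v, x, y} := by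
  unfold St.linkNbrs
  rw [← Array.foldl_toList]
  have gen : ∀ (L : List ℕ) (acc : List ℕ), (∀ t ∈ L, TriValid t) →
      (y ∈ L.foldl (fun l t => if (tmem t v && tmem t x && x != v) = true then
          (if (others t v).1 = x then (others t v).2 else (others t v).1) :: l else l) acc ↔
        y ∈ acc ∨ ∃ t ∈ L, v ∈ tset t ∧ x ∈ tset t ∧ tset t = {v, x, y}) := by
    intro L
    induction L with
    | nil => intro acc _; simp
    | cons t L ih =>
      intro acc hval
      rw [List.foldl_cons, ih _ (fun t' ht' => hval t' (by simp [ht']))]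
      have hvt := hval t (by simp)
      by_cases hc : (tmem t v && tmem t x && x != v) = true
      · rw [if_pos hc, List.mem_cons]
        simp only [Bool.and_eq_true, bne_iff_ne, ne_eq] at hc
        obtain ⟨⟨hv, hx⟩, -⟩ := hc
        have hv' := tmem_iff.1 hv
        have hx' := tmem_iff.1 hx
        obtain ⟨n1, n2, n12, hset⟩ := others_spec hvt hv'
        -- which of the two others is `x`
        have hx3 : x = (others t v).1 ∨ x = (others t v).2 := by
          rw [hset] at hx'
          simp only [Finset.mem_insert, Finset.mem_singleton] at hx'
          rcases hx' with h | h | h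
          · exact absurd h hxv
          · exact Or.inl h
          · exact Or.inr h
        constructor
        · rintro ((rfl | hacc) | ⟨t', ht', h'⟩)
          · right
            refine ⟨t, by simp, hv', hx', ?_⟩
            rcases hx3 with h | h
            · rw [if_pos h.symm, hset, ← h]
            · have hne : (others t v).1 ≠ x := by rw [h]; exact n12
              rw [if_neg hne, hset, ← h]
              -- {v, o1, x} = {v, x, o1}
              ext z; simp only [Finset.mem_insert, Finset.mem_singleton]; tauto
          · exact Or.inl hacc
          · exact Or.inr ⟨t', by simp [ht'], h'⟩
        · rintro (hacc | ⟨t', ht', hv'', hx'', hset'⟩)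
          · exact Or.inl (Or.inr hacc)
          · rcases List.mem_cons.1 ht' with rfl | ht'
            · left; left
              -- `y` is the third vertex of `t`
              rcases hx3 with h | h
              · rw [if_pos h.symm]
                have : (others t' v).2 ∈ ({v, x, y} : Finset ℕ) := by rw [← hset', hset]; simp
                simp only [Finset.mem_insert, Finset.mem_singleton] at this
                rcases this with e | e | e
                · exact absurd e.symm n2
                · rw [h] at e; exact absurd e.symm n12
                · exact e.symm
              · have hne : (others t' v).1 ≠ x := by rw [h]; exact n12
                rw [if_neg hne]
                have : (others t' v).1 ∈ ({v, x, y} : Finset ℕ) := by rw [← hset', hset]; simp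
                simp only [Finset.mem_insert, Finset.mem_singleton] at this
                rcases this with e | e | e
                · exact absurd e.symm n1
                · exact absurd e hne
                · exact e.symm
            · exact Or.inr ⟨t', ht', hv'', hx'', hset'⟩
      · rw [if_neg hc]
        constructor
        · rintro (hacc | ⟨t', ht', h'⟩)
          · exact Or.inl hacc
          · exact Or.inr ⟨t', by simp [ht'], h'⟩
        · rintro (hacc | ⟨t', ht', hv'', hx'', hset'⟩)
          · exact Or.inl hacc
          · rcases List.mem_cons.1 ht' with rfl | ht'
            · exfalso; apply hc
              simp only [Bool.and_eq_true, bne_iff_ne, ne_eq]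
              exact ⟨⟨tmem_iff.2 hv'', tmem_iff.2 hx''⟩, hxv⟩
            · exact Or.inr ⟨t', ht', hv'', hx'', hset'⟩
  rw [gen _ [] hR.valid]
  simp

end Counting

/-! ### Part B. The single-cycle link axiom at work -/

section Link

variable {M : KConf κ} {s : St}

/-- **A closed label has all its triangles placed.**  If `v` lies in a placed triangle, every
side at `v` lying in a placed triangle lies in two (`gsc v u ≠ 1`, counts `≤ 2`), then every
triangle of `M` at `v` is placed. [cite: Hales2012, proof of Lemma 9] -/
theorem all_placed_of_closed {M : KConf κ} {s : St} (hR : Realizes M s) {v : ℕ} (hv : v < 12)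
    (hne : ∀ u, u < 12 → u ≠ v → s.gsc v u ≠ 1) {t₀ : ℕ} (ht₀ : t₀ ∈ s.tris.toList) (hv₀ : v ∈ tset t₀)
    {t'' : Finset ℕ} (hT : t'' ∈ M.T) (hv'' : v ∈ t'') : ∃ t ∈ s.tris.toList, tset t = t'' := by
  classical
  set A : Finset (Finset ℕ) := (M.T.filter fun t' => v ∈ t').filter fun t' => ∃ t ∈ s.tris.toList, tset t = t' with hA
  have hAsub : A ⊆ M.T.filter fun t' => v ∈ t' := Finset.filter_subset _ _
  have hAne : A.Nonempty := ⟨tset t₀, by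
    rw [hA, Finset.mem_filter, Finset.mem_filter]; exact ⟨⟨hR.mem t₀ ht₀, hv₀⟩, t₀, ht₀, rfl⟩⟩
  have hcl : ∀ t ∈ A, ∀ t' ∈ M.T, v ∈ t' → (t ∩ t').card = 2 → t' ∈ A := by
    intro t ht t' ht' hvt' h2
    rw [hA, Finset.mem_filter, Finset.mem_filter] at ht
    obtain ⟨⟨-, hvt⟩, tp, htp, rfl⟩ := ht
    obtain ⟨x, hxv, hx, hx'⟩ := exists_common_of_inter_two v h2
    have hx12 : x < 12 := lt_of_mem_tset (hR.valid tp htp) hx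
    -- the side `{v, x}` is in a placed triangle, hence in two
    have hge : s.gsc v x ≠ 0 := by
      rw [gsc_eq_length hR hv hx12 hxv.symm]
      intro h0
      have : tp ∈ s.onSideL v x := by
        unfold St.onSideL; rw [List.mem_filter]; simp only [Bool.and_eq_true]
        exact ⟨htp, tmem_iff.2 hvt, tmem_iff.2 hx⟩
      rw [List.length_eq_zero_iff.1 h0] at this
      simp at this
    have h2' : s.gsc v x = 2 := by
      have := gsc_le_two hR hv hx12 hxv.symm
      have := hne x hx12 hxv
      omega
    obtain ⟨t₁, ht₁, e⟩ := placed_of_gsc_two hR hv hx12 hxv.symm h2' ht' hvt' hx'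
    rw [hA, Finset.mem_filter, Finset.mem_filter]
    exact ⟨⟨ht', hvt'⟩, t₁, ht₁, e⟩
  have hAeq := M.link v hv A hAsub hAne hcl
  have : t'' ∈ A := by rw [hAeq, Finset.mem_filter]; exact ⟨hT, hv''⟩
  rw [hA, Finset.mem_filter] at this
  exact this.2

end Link

end GSearch

end Summit.Ventures.Crystal3D.Kissing125
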